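import Summits.CriticalPhenomena.Ising3DConformalLimit.Theses.LocalisationClock
import HarnessLib

/-!
# Crux-ideate sketch — `LocalisationClock.ImryMaWindowNoise` (stmt-CriticalPhenomena-15883), round 1, ideator k = 1

First-lemma signatures for the two crux idea cards filed by this seat
(`Ideas/nishimori-two-variance.md`, `Ideas/deficit-bins.md`). Nothing here is a registered line.
All functionals below are the crux's verbatim `let` block, factored into `def`s with the same bodies
(`w, tilt, m, Af, r, P, σ2`), plus: `V` (posterior block variance), `Eτ` (noise average at a frozen truth),
`rmax` (zero-field rate `‖G𝟙‖²`), `Window`.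
-/

noncomputable section

namespace Summit.CriticalPhenomena.Ising3DConformalLimit.Cruxes.ImryMaWindowNoise.IdeaSketch

open scoped BigOperators Topology Manifold Classical MeasureTheory ProbabilityTheory Matrix InnerProductSpace ComplexConjugate ContinuousMap
open Filter Set Function TopologicalSpace MeasureTheory

/-- Sites of the box `Λ_L = box 3 L`. -/
abbrev Box (L : ℕ) := ↥(Literature.Probability.LatticeModels.box 3 L)
/-- Spin configurations on the box. -/
abbrev Cfg (L : ℕ) := Box L → ℤˣ
/-- Site fields on the box. -/
abbrev Fld (L : ℕ) := Box L → ℝ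

/-- `β_c(3)`. -/
def βc : ℝ := Literature.Probability.LatticeModels.criticalBeta 3

/-- Marginal `w_L` of the critical `+` state on the box (crux's `w`). -/
def w (L : ℕ) (τ : Cfg L) : ℝ :=
  Literature.Probability.LatticeModels.plusExpect 3 βc 0 (fun σ => if (∀ x : Box L, σ x = τ x) then 1 else 0)

/-- Block spin `M(τ) = Σ_x τ_x`. -/
def Mag (L : ℕ) (τ : Cfg L) : ℝ := ∑ x, ((τ x : ℤ) : ℝ)

/-- Posterior (tilted) expectation `E_y[g]` (crux's `tilt`). -/
def tilt (L : ℕ) (y : Fld L) (g : Cfg L → ℝ) : ℝ :=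
  (∑ τ, w L τ * g τ * Real.exp (∑ x, y x * ((τ x : ℤ) : ℝ))) /
    (∑ τ, w L τ * Real.exp (∑ x, y x * ((τ x : ℤ) : ℝ)))

/-- Posterior polarisation `m(y) = E_y M` (crux's `m`). -/
def m (L : ℕ) (y : Fld L) : ℝ := tilt L y (Mag L)

/-- `A_x(y) = Cov_y(τ_x, M)` (crux's `Af`). -/
def Af (L : ℕ) (y : Fld L) (x : Box L) : ℝ :=
  tilt L y (fun τ => ((τ x : ℤ) : ℝ) * Mag L τ) - tilt L y (fun τ => ((τ x : ℤ) : ℝ)) * m L y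

/-- Clock rate `r(y) = Σ_x Cov_y(τ_x, M)²` (crux's `r`). -/
def r (L : ℕ) (y : Fld L) : ℝ := ∑ x, Af L y x ^ 2

/-- NEW: posterior block variance `V(y) = E_y[M²] − m(y)² = Σ_x A_x(y)`. -/
def V (L : ℕ) (y : Fld L) : ℝ := tilt L y (fun τ => Mag L τ ^ 2) - m L y ^ 2

/-- The channel noise: standard Gaussian product measure on fields. -/
def γ (L : ℕ) : Measure (Fld L) := Measure.pi fun _ : Box L => ProbabilityTheory.gaussianReal 0 1

/-- NEW: noise average at a FROZEN truth `τ`: `E_Z Φ(sτ + √s Z)`. -/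
def Eτ (L : ℕ) (s : ℝ) (τ : Cfg L) (Φ : Fld L → ℝ) : ℝ :=
  ∫ z, Φ (fun x => s * ((τ x : ℤ) : ℝ) + Real.sqrt s * z x) ∂(γ L)

/-- Planted expectation `P_{L,s}[Φ] = Σ_τ w_L(τ)·E_Z Φ(sτ + √s Z)` (crux's `P`, by `rfl`). -/
def P (L : ℕ) (s : ℝ) (Φ : Fld L → ℝ) : ℝ := ∑ τ, w L τ * Eτ L s τ Φ

/-- `σ_L² = ⟨M_L²⟩⁺_{β_c}` (crux's `σ2`). -/
def σ2 (L : ℕ) : ℝ :=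
  Literature.Probability.LatticeModels.plusExpect 3 βc 0
    (fun σ => (∑ x ∈ Literature.Probability.LatticeModels.box 3 L, Literature.Probability.LatticeModels.spinAt x σ) ^ 2)

/-- NEW: the zero-field rate `r(0) = ‖G𝟙‖²`, the pathwise ceiling of `r` (Ding–Song–Sun). -/
def rmax (L : ℕ) : ℝ := r L 0

/-- The crux's interquantile window at level `[a,b]`. -/
def Window (a b : ℝ) (L : ℕ) (s : ℝ) : Prop :=
  0 ≤ s ∧ a * σ2 L ≤ P L s (fun y => m L y ^ 2) ∧ P L s (fun y => m L y ^ 2) ≤ b * σ2 L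

/-- The crux restated over the factored functionals (same bodies as the route decl's `let` block). -/
def CruxRestated : Prop :=
  ∃ a b c : ℝ, 0 < a ∧ a < b ∧ b < 1 ∧ 0 < c ∧ ∃ L₀ : ℕ, ∀ L ≥ L₀, ∀ s : ℝ, 0 ≤ s →
    a * σ2 L ≤ P L s (fun y => m L y ^ 2) → P L s (fun y => m L y ^ 2) ≤ b * σ2 L →
      P L s (fun y => r L y * m L y ^ 2) - P L s (r L) * P L s (fun y => m L y ^ 2)
        ≤ -(c * (P L s (r L) * P L s (fun y => m L y ^ 2)))

/-- Certificate that the factored functionals ARE the crux's: the route decl unfolds to `CruxRestated`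
by `rfl` (zeta/delta only). -/
theorem crux_iff_restated :
    Summit.CriticalPhenomena.Ising3DConformalLimit.Theses.LocalisationClock.ImryMaWindowNoise ↔ CruxRestated :=
  Iff.rfl

/-! ## Card B — `nishimori-two-variance`: the window covariance (V-form) is a difference of variances -/

/-- B0 · THE LEVER (exact, provable now by Bayes/Fubini + algebra; verified numerically to 4 digits on six
toys, kit j024709/v2): with `g(τ) := E_Z[m² | τ* = τ]`, `h(τ) := g(τ) − M(τ)²/2`,
`−Cov_P(V, m²) = E_τ Var_Z(m² | τ) + Var_w(h) − Var_w(M²)/4`.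
Ingredients: tower property + the Nishimori/Bayes identity `E_P[E_y[M²]·φ(y)] = E_P[M(τ*)²·φ(y)]`
(the tilt by `e^{⟨y,τ⟩}` is the exact posterior because `|τ|² = |Λ|` is constant), then complete the square. -/
def ClockVarianceIdentity : Prop :=
  ∀ (L : ℕ) (s : ℝ), 0 ≤ s →
    let g : Cfg L → ℝ := fun τ => Eτ L s τ (fun y => m L y ^ 2) ;
    let EVarZ : ℝ := ∑ τ, w L τ * (Eτ L s τ (fun y => m L y ^ 4) - g τ ^ 2) ;
    let h : Cfg L → ℝ := fun τ => g τ - Mag L τ ^ 2 / 2 ;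
    let VarTruth : ℝ := (∑ τ, w L τ * h τ ^ 2) - (∑ τ, w L τ * h τ) ^ 2 ;
    let VarMsq : ℝ := (∑ τ, w L τ * Mag L τ ^ 4) - (∑ τ, w L τ * Mag L τ ^ 2) ^ 2 ;
    -(P L s (fun y => V L y * m L y ^ 2) - P L s (V L) * P L s (fun y => m L y ^ 2))
      = EVarZ + VarTruth - VarMsq / 4

/-- B1 · THE TRANSFER `C⁺` (heart): VARIANCE FLOOR on the window — the noise-driven variance of the squared
polarisation at a frozen truth, plus the truth-variance of `E_Z[m²|τ*] − M*²/2`, beats a quarter of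
`Var(M*²) = (2 − g_L)σ_L⁴` (Lebowitz: `≤ 2σ_L⁴`) by `c·P[V]·P[m²]`. Both left terms are variances, hence
lower-boundable by projections (Hermite/chaos in `Z`, Cacoullos; FKG-functional variance under `w_L`). -/
def VarianceFloor : Prop :=
  ∃ a b c : ℝ, 0 < a ∧ a < b ∧ b < 1 ∧ 0 < c ∧ ∃ L₀ : ℕ, ∀ L ≥ L₀, ∀ s : ℝ, Window a b L s →
    let g : Cfg L → ℝ := fun τ => Eτ L s τ (fun y => m L y ^ 2) ;
    let EVarZ : ℝ := ∑ τ, w L τ * (Eτ L s τ (fun y => m L y ^ 4) - g τ ^ 2) ;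
    let h : Cfg L → ℝ := fun τ => g τ - Mag L τ ^ 2 / 2 ;
    let VarTruth : ℝ := (∑ τ, w L τ * h τ ^ 2) - (∑ τ, w L τ * h τ) ^ 2 ;
    let VarMsq : ℝ := (∑ τ, w L τ * Mag L τ ^ 4) - (∑ τ, w L τ * Mag L τ ^ 2) ^ 2 ;
    VarMsq / 4 + c * (P L s (V L) * P L s (fun y => m L y ^ 2)) ≤ EVarZ + VarTruth

/-- B2 · RATE UPGRADE (size M?, toy ratio `R/R_V ∈ [1.3, 1.6]` in 54/54 rows): on the window the rate is at
least as anti-correlated with `m²` as the posterior variance is: `Cov(r,m²)·P[V] ≤ Cov(V,m²)·P[r]`. -/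
def RateUpgrade : Prop :=
  ∀ a b : ℝ, 0 < a → a < b → b < 1 → ∃ L₀ : ℕ, ∀ L ≥ L₀, ∀ s : ℝ, Window a b L s →
    (P L s (fun y => r L y * m L y ^ 2) - P L s (r L) * P L s (fun y => m L y ^ 2)) * P L s (V L)
      ≤ (P L s (fun y => V L y * m L y ^ 2) - P L s (V L) * P L s (fun y => m L y ^ 2)) * P L s (r L)

/-- Support (Nishimori, provable now): `P[V] = σ_L² − P[m²]` (law of total variance under the planted law),
whence `P[V] ≥ (1−b)σ_L² > 0` on the window. -/
def TotalVariance : Prop :=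
  ∀ (L : ℕ) (s : ℝ), 0 ≤ s → P L s (V L) = σ2 L - P L s (fun y => m L y ^ 2)

/-! ## Card A — `deficit-bins`: the Ding–Song–Sun deficit `d = 1 − r/r(0) ∈ [0,1]`, binned by polarisation -/

/-- A1 · (A⁺) polarised ⇒ stiff, excess-weighted: `P[d·(m²−q)₊] ≥ (P[d] + cp)·P[(m²−q)₊]`, `q = P[m²]`. -/
def DeficitAbove : Prop :=
  ∀ a b : ℝ, 0 < a → a < b → b < 1 → ∃ cp : ℝ, 0 < cp ∧ ∃ L₀ : ℕ, ∀ L ≥ L₀, ∀ s : ℝ, Window a b L s →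
    let q : ℝ := P L s (fun y => m L y ^ 2) ;
    let d : Fld L → ℝ := fun y => 1 - r L y / rmax L ;
    let pos : Fld L → ℝ := fun y => max (m L y ^ 2 - q) 0 ;
    (P L s d + cp) * P L s pos ≤ P L s (fun y => d y * pos y)

/-- A2 · (A⁻) unpolarised ⇒ susceptible on average (domain states do not dominate the unpolarised class):
`P[d·(q−m²)₊] ≤ (P[d] − cm)·P[(q−m²)₊]`. -/
def DeficitBelow : Prop :=
  ∀ a b : ℝ, 0 < a → a < b → b < 1 → ∃ cm : ℝ, 0 < cm ∧ ∃ L₀ : ℕ, ∀ L ≥ L₀, ∀ s : ℝ, Window a b L s →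
    let q : ℝ := P L s (fun y => m L y ^ 2) ;
    let d : Fld L → ℝ := fun y => 1 - r L y / rmax L ;
    let neg : Fld L → ℝ := fun y => max (q - m L y ^ 2) 0 ;
    P L s (fun y => d y * neg y) ≤ (P L s d - cm) * P L s neg

/-- A3 · spread of the squared polarisation in `L¹`: `P[|m² − q|] ≥ c₃·q` (size M; cf. census (W)). -/
def PolarisationSpread : Prop :=
  ∀ a b : ℝ, 0 < a → a < b → b < 1 → ∃ c₃ : ℝ, 0 < c₃ ∧ ∃ L₀ : ℕ, ∀ L ≥ L₀, ∀ s : ℝ, Window a b L s →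
    let q : ℝ := P L s (fun y => m L y ^ 2) ;
    c₃ * q ≤ P L s (fun y => |m L y ^ 2 - q|)

/-- Support (DSS Cor. 1.3 termwise + FKG, provable from the named fact
`Literature.Probability.LatticeModels.DingSongSun2022_signedFieldDomination`): `0 ≤ r(y) ≤ r(0)` pathwise,
hence `P[r] ≤ rmax`. -/
def RateCeiling : Prop :=
  ∀ (L : ℕ) (y : Fld L), 0 ≤ r L y ∧ r L y ≤ rmax L

/-! ## Real-arithmetic cores of the two compositions (kernel-checked) -/

/-- Card A glue: from the two bin inequalities and `E pos = E neg` (centring), `Cov(d, m²) ≥ min(cp,cm)·E|m²−q|`. -/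
theorem cov_from_bins {Edpos Edneg Ed Epos Eneg cp cm : ℝ} (hcp : 0 < cp) (hcm : 0 < cm)
    (hA : (Ed + cp) * Epos ≤ Edpos) (hB : Edneg ≤ (Ed - cm) * Eneg) (hcentre : Epos = Eneg)
    (hpos : 0 ≤ Epos) :
    min cp cm * (Epos + Eneg) ≤ Edpos - Edneg - Ed * (Epos - Eneg) := by
  have h1 : min cp cm ≤ cp := min_le_left _ _
  have h2 : min cp cm ≤ cm := min_le_right _ _
  subst hcentre
  nlinarith [mul_le_mul_of_nonneg_right h1 hpos, mul_le_mul_of_nonneg_right h2 hpos]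

/-- Card B glue: identity + floor give `Cov(V,m²) ≤ −c·P[V]·P[m²]`; the rate upgrade and `P[V] > 0`
transport it to `r`. -/
theorem crux_core_from_B {CovV CovR PV Pr Pm EVarZ VarTruth VarMsq c : ℝ}
    (hid : -CovV = EVarZ + VarTruth - VarMsq / 4)
    (hfloor : VarMsq / 4 + c * (PV * Pm) ≤ EVarZ + VarTruth)
    (hup : CovR * PV ≤ CovV * Pr) (hPV : 0 < PV) (hPr : 0 ≤ Pr) :
    CovR ≤ -(c * (Pr * Pm)) := by
  have hV : CovV ≤ -(c * (PV * Pm)) := by linarith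
  have h1 : CovV * Pr ≤ -(c * (PV * Pm)) * Pr := mul_le_mul_of_nonneg_right hV hPr
  have h2 : CovR * PV ≤ (-(c * (Pr * Pm))) * PV := by
    have : -(c * (PV * Pm)) * Pr = (-(c * (Pr * Pm))) * PV := by ring
    linarith [hup, h1]
  exact le_of_mul_le_mul_right h2 hPV

/-! ## Card C — `truth-alignment`: swap one posterior polarisation for the truth's block spin -/

/-- C0 · THE LEVER (exact Nishimori swaps, provable now by Bayes/Fubini): `P[m²] = Σ_τ w(τ) M(τ) E_Z[m | τ]` and
`P[r·m²] = Σ_τ w(τ) M(τ) E_Z[r·m | τ]` — one factor `m(y) = E_y M` is replaced by the TRUTH's block spin.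
(Checked numerically: swapChk ≈ 0 on six toys, kit job toy-cardC-15883.) -/
def TruthAlignmentSwap : Prop :=
  ∀ (L : ℕ) (s : ℝ), 0 ≤ s →
    P L s (fun y => m L y ^ 2) = ∑ τ, w L τ * (Mag L τ * Eτ L s τ (m L)) ∧
    P L s (fun y => r L y * m L y ^ 2) = ∑ τ, w L τ * (Mag L τ * Eτ L s τ (fun y => r L y * m L y))

/-- C1 · THE TRANSFER `C⁺` (heart): TRUTH-CONDITIONAL ANTI-CORRELATION THROUGH THE NOISE — weighted by the
truth's block spin, the covariance OVER THE GAUSSIAN NOISE ALONE (truth frozen) of the clock rate `r` and the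
polarisation `m` (first power) is negative of relative size `c`:
`Σ_τ w(τ) M(τ)·Cov_Z(r, m | τ) ≤ −c·P[r]·P[m²]` on the window. (Toys: carries 70–100 % of the crux covariance;
normalised value ≈ −0.3·g_L.) Conditionally on `τ` the field is a PRODUCT Gaussian measure, `m` is
coordinatewise increasing (FKG), and `Cov_Z(r,m|τ) = ∫₀¹ E⟨∇_Z r, ∇_Z m⟩_α dα = 2s·∫₀¹ E[κ₃^y(A·τ, Ã·τ, M)] dα`
(Gaussian interpolation): a planted GHS inequality of THIRD order with modulus. -/
def TruthConditionalAnticorrelation : Prop :=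
  ∃ a b c : ℝ, 0 < a ∧ a < b ∧ b < 1 ∧ 0 < c ∧ ∃ L₀ : ℕ, ∀ L ≥ L₀, ∀ s : ℝ, Window a b L s →
    ∑ τ, w L τ * (Mag L τ * (Eτ L s τ (fun y => r L y * m L y) - Eτ L s τ (r L) * Eτ L s τ (m L)))
      ≤ -(c * (P L s (r L) * P L s (fun y => m L y ^ 2)))

/-- C2 · BETWEEN-TRUTH SIGN (support, size M?): truths with a large block spin produce, on average over the
noise, a clock rate no larger than the planted mean, in the `M·E_Z[m|τ]`-weighted sense:
`Σ_τ w(τ) M(τ) E_Z[m|τ]·(E_Z[r|τ] − P[r]) ≤ 0`. (Toys: ≤ 0 in 30/30 correlated rows, ≈ 0 for product laws.) -/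
def BetweenTruthSign : Prop :=
  ∀ a b : ℝ, 0 < a → a < b → b < 1 → ∃ L₀ : ℕ, ∀ L ≥ L₀, ∀ s : ℝ, Window a b L s →
    ∑ τ, w L τ * (Mag L τ * Eτ L s τ (m L) * (Eτ L s τ (r L) - P L s (r L))) ≤ 0

/-- Card C glue (real arithmetic): with the swaps, `Cov(r,m²) = T + B` termwise
(`M·(E[rm|τ] − E r|τ·E m|τ) + M·E m|τ·(E r|τ − P r) = M·E[rm|τ] − P r·M·E m|τ`), so `T ≤ −cX`, `B ≤ 0` give the crux. -/
theorem crux_core_from_C {ι : Type*} (S : Finset ι) (wt Mg Erm Er Em : ι → ℝ) (Pr Pm2 Prm2 c : ℝ)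
    (hswap1 : Pm2 = ∑ i ∈ S, wt i * (Mg i * Em i))
    (hswap2 : Prm2 = ∑ i ∈ S, wt i * (Mg i * Erm i))
    (hT : ∑ i ∈ S, wt i * (Mg i * (Erm i - Er i * Em i)) ≤ -(c * (Pr * Pm2)))
    (hB : ∑ i ∈ S, wt i * (Mg i * Em i * (Er i - Pr)) ≤ 0) :
    Prm2 - Pr * Pm2 ≤ -(c * (Pr * Pm2)) := by
  have key : Prm2 - Pr * Pm2
      = (∑ i ∈ S, wt i * (Mg i * (Erm i - Er i * Em i))) + ∑ i ∈ S, wt i * (Mg i * Em i * (Er i - Pr)) := by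
    rw [hswap1, hswap2, Finset.mul_sum, ← Finset.sum_sub_distrib, ← Finset.sum_add_distrib]
    refine Finset.sum_congr rfl fun i _ => ?_
    ring
  linarith [key, hT, hB]

end Summit.CriticalPhenomena.Ising3DConformalLimit.Cruxes.ImryMaWindowNoise.IdeaSketch
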